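import Mathlib.Geometry.Manifold.SmoothEmbedding
import Mathlib.Geometry.Manifold.Instances.Real
import Mathlib.Analysis.InnerProductSpace.PiL2
import Mathlib.Analysis.Calculus.ContDiff.Basic
import Mathlib.Topology.Homotopy.Path
import HarnessLib

/-!
# Lawson–Michelsohn (1984): surrounding a `1`-thin domain by a hypersurface of positive mean
# curvature (Theorem 6.1 = Theorem 1.4), Euclidean ambient space, as a named fact

Topic `Geometry/Riemannian`; namespace `Literature.Geometry.Riemannian`. Source: H. B. Lawson,
M.-L. Michelsohn, *Embedding and surrounding with positive mean curvature*, Invent. Math. 77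
(1984), 399–419 [LawsonMichelsohn1984] (read in the GDZ digitisation of Invent. Math. 77,
pp. 399–404, 415–416).

The paper's exterior theorem (§1, (1.4); proved as (6.1) in §6, p. 416): "Let `M̄` be a riemannian
`n`-manifold with `n ≠ 4`, and let `f : M ↪ M̄` be an embedded hypersurface which bounds a compact
domain `D_f` in `M̄`. Then `f` is strongly isotopic to an embedding of positive mean curvature if
`D_f` is 1-thin. When `Ric_{M̄} ≥ 0`, the embedding has this property if and only if `D_f` is
1-thin." with (p. 400) "**Definition.** A compact `n`-manifold `M` will be called *1-thin* if
(a) `π₁(M, ∂M) = 0` and (b) if `n = 3`, then `M` contains no fake 3-cells", (p. 416) "Two such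
embeddings `f₀, f₁` will be said to be *strongly isotopic* if there exists an embedding
`F : N × [0, 1] → M̄` such that `F|_{N × {k}} = f_k` for `k = 0, 1`", and (6.1): "Suppose
`dim N ≥ 4`. Then the embedding `f : N ↪ M̄` is strongly isotopic to an embedding of positive mean
curvature if `π₁(D_f, N) = 0`. […] Here the mean curvature will be positive with respect to the
outer normal of `D_f`. Note that in the first statement there are absolutely no restrictions on the
metric on `M̄`. Of course an interesting case is where `M̄ = ℝⁿ` (`n ≥ 5`) with the euclidean metric.
Here `D_f` is just the bounded component of `ℝⁿ - N`." Mean curvature is `H = trace B`,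
`B(V) = ∇_V ν` for the chosen unit normal `ν` (p. 400; for `∂D` the outer normal, so round spheres
have `H = n - 1 > 0`), and for an implicitly defined hypersurface `{F = t}`, `‖∇F‖ > 0`, the
second fundamental form with respect to `ν = ∇F/‖∇F‖` is `Hess_F / ‖∇F‖` on tangent vectors
(§2, (2.4)–(2.6), (2.12)).

## What is vendored, and the renderings

`LawsonMichelsohn1984_surrounding` is Theorem 6.1 in the "interesting case" `M̄ = ℝ^{m+1}` with the
Euclidean metric, `m = dim N ≥ 4`, in the implicit-function model of compact domains used by the
`SmoothPoincare4` route `ConvexityLadder` (rung (c), `CvxMeanConvexRepresentative`):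

* *the hypersurface and its domain*: a compact connected boundaryless `m`-manifold `N`, a smooth
  embedding `e : N → ℝ^{m+1}` and a smooth `F : ℝ^{m+1} → ℝ` with `e(N) = {F = 0}`, `dF ≠ 0` on
  `{F = 0}` and `D := {F ≤ 0}` compact — so `D` is the compact domain bounded by `e(N)`
  (`∂D = {F = 0} = e(N)`; it is the closure of the bounded component of `ℝ^{m+1} ∖ e(N)`, unique
  by *loc. cit.* since `H_m(ℝ^{m+1}) = 0`);
* *1-thin* (`m + 1 ≥ 5`, so only clause (a)): `π₁(D, ∂D) = 0` at every base point, rendered by the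
  compression criterion — every path in `D` with end-points on `∂D` is homotopic in `D`, relative to
  its end-points, to a path on `∂D` (`RelPiOneTrivial`, for the subspace `D` and its subset `∂D`;
  Hatcher, *Algebraic Topology*, §4.1, compression lemma);
* *strongly isotopic to an embedding of positive mean curvature*: there are a smooth embedding
  `Φ : N × [0, 1] → ℝ^{m+1}` with `Φ(·, 0) = e`, and a smooth `F'` presenting the compact domain
  `D' = {F' ≤ 0}` bounded by `e' := Φ(·, 1)` (`e'(N) = {F' = 0}`, `dF' ≠ 0` there), whose boundary has
  positive mean curvature with respect to the outer normal `∇F'/‖∇F'‖`: for `x ∈ {F' = 0}` and every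
  orthonormal `m`-frame `v` of `ker dF'_x = T_x ∂D'`, `∑ᵢ Hess F'_x(vᵢ, vᵢ) > 0` (this is
  `‖∇F'‖ · H > 0` by (2.4)–(2.6); the existence of a defining function `F'` for the smooth compact
  domain `D'` is the standard collar/defining-function fact and only serves to express `H > 0`
  in the calculus vocabulary of Mathlib, which has no second fundamental form).

Not vendored: the general Riemannian ambient manifold, the converse under `Ric ≥ 0`, dimension
`n = 3` (§4, fake 3-cells), Theorems 1.1–1.3, 5.1–5.2 (intrinsic metrics with `K > 0`, `H > 0`), the
handle-attaching Theorem 3.1 and the bridge principle (§7). Mathlib has smooth embeddings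
(`Manifold.IsSmoothEmbedding`), the manifold-with-boundary structure on `N × [0, 1]`
(`instIccChartedSpace`, products of models with corners), paths and homotopy relative to end-points
(`Path.Homotopic`), `Orthonormal`, `fderiv`, `iteratedFDeriv`; it has no mean curvature, handle
decompositions or relative homotopy groups, whence the renderings above.

## References

* H. B. Lawson, Jr., M.-L. Michelsohn, *Embedding and surrounding with positive mean curvature*,
  Invent. Math. 77 (1984), 399–419, doi:10.1007/bf01388830: §1 (1.4) and Definition of 1-thin
  (p. 400), §2 (2.4)–(2.6), (2.12), §6 Theorem (6.1) (p. 416). [LawsonMichelsohn1984]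
* A. Hatcher, *Algebraic Topology* (2002), §4.1 (relative homotopy groups, compression lemma).
  [HatcherAT2002]
-/

noncomputable section

open scoped Manifold ContDiff
open Set

namespace Literature.Geometry.Riemannian

/-! ### `π₁(X, A) = 0` by the compression criterion -/

/-- **`π₁(X, A) = 0` at every base point** for a space `X` and a subset `A ⊆ X`, in the form of
the compression criterion: every path in `X` whose end-points lie in `A` is homotopic, relative to
its end-points, to a path lying in `A` (a map `(I, ∂I) → (X, A)` represents `0` in `π₁(X, A, x₀)`
iff it is homotopic rel `∂I` to a map into `A`; Hatcher, *Algebraic Topology*, §4.1). This is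
clause (a), "`π₁(M, ∂M) = 0`", of Lawson–Michelsohn's definition of a *1-thin* compact manifold
(Invent. Math. 77 (1984), p. 400), applied to `X = M`, `A = ∂M`. [cite: HatcherAT2002, §4.1] -/
def RelPiOneTrivial (X : Type*) [TopologicalSpace X] (A : Set X) : Prop :=
  ∀ ⦃x y : X⦄, x ∈ A → y ∈ A → ∀ γ : Path x y, ∃ γ' : Path x y, range γ' ⊆ A ∧ γ.Homotopic γ'

/-- Unfolding lemma for `RelPiOneTrivial`. [folklore] -/
theorem relPiOneTrivial_iff (X : Type*) [TopologicalSpace X] (A : Set X) :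
    RelPiOneTrivial X A ↔ ∀ ⦃x y : X⦄, x ∈ A → y ∈ A → ∀ γ : Path x y,
      ∃ γ' : Path x y, range γ' ⊆ A ∧ γ.Homotopic γ' :=
  Iff.rfl

/-- `π₁(X, X) = 0`: every path compresses into `A = univ` (take `γ' = γ`). [folklore] -/
theorem relPiOneTrivial_univ (X : Type*) [TopologicalSpace X] : RelPiOneTrivial X univ :=
  fun _ _ _ _ γ => ⟨γ, subset_univ _, Path.Homotopic.refl γ⟩

/-- `RelPiOneTrivial` is monotone in `A` for supersets that still contain the compressed paths:
if every path with end-points in `A` compresses into `A`, and `A ⊆ B`, then every path with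
end-points in `A` compresses into `B`. [folklore] -/
theorem RelPiOneTrivial.exists_subset {X : Type*} [TopologicalSpace X] {A B : Set X}
    (h : RelPiOneTrivial X A) (hAB : A ⊆ B) {x y : X} (hx : x ∈ A) (hy : y ∈ A) (γ : Path x y) :
    ∃ γ' : Path x y, range γ' ⊆ B ∧ γ.Homotopic γ' := by
  obtain ⟨γ', hγ', hh⟩ := h hx hy γ
  exact ⟨γ', hγ'.trans hAB, hh⟩

/-! ### Theorem 6.1 in Euclidean space -/

/-- **Lawson–Michelsohn's surrounding theorem in `ℝ^{m+1}`, `m ≥ 4`** (Invent. Math. 77 (1984),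
Theorem (6.1), p. 416, the case "`M̄ = ℝⁿ` (`n ≥ 5`) with the euclidean metric" singled out there;
= Theorem (1.4) of the Introduction): "Suppose `dim N ≥ 4`. Then the embedding `f : N ↪ M̄` is
strongly isotopic to an embedding of positive mean curvature if `π₁(D_f, N) = 0`. […] Here the
mean curvature will be positive with respect to the outer normal." Statement: let `N` be a compact
connected boundaryless `m`-manifold, `4 ≤ m`, `e : N → ℝ^{m+1}` a smooth embedding whose image is
the regular zero set `{F = 0}` of a smooth `F` with `D = {F ≤ 0}` compact (the compact domain
bounded by `e(N)`), and suppose `π₁(D, ∂D) = 0` (`RelPiOneTrivial` for the subspace `D` and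
`∂D = {F = 0}`: `D` is *1-thin*, p. 400). Then there are a smooth embedding
`Φ : N × [0, 1] → ℝ^{m+1}` with `Φ(·, 0) = e` (a *strong isotopy*, p. 416) and a smooth `F'` with
`{F' ≤ 0}` compact, `dF' ≠ 0` on `{F' = 0} = Φ(N × {1})`, such that the hypersurface
`Φ(N × {1}) = ∂{F' ≤ 0}` has positive mean curvature with respect to the outer normal
`∇F'/‖∇F'‖`: `∑ᵢ Hess F'_x(vᵢ, vᵢ) > 0` for every `x ∈ {F' = 0}` and every orthonormal `m`-frame
`v` of `ker dF'_x` (`= ‖∇F'‖ H`, op. cit. §2 (2.4)–(2.6)). See the module docstring for the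
renderings. Named fact (D-0014). [cite: LawsonMichelsohn1984, Thm. (6.1) (p. 416) and (1.4), Def. p. 400] -/
def LawsonMichelsohn1984_surrounding : Prop :=
  ∀ (m : ℕ), 4 ≤ m →
    ∀ (N : Type) [TopologicalSpace N] [T2Space N] [SecondCountableTopology N] [CompactSpace N]
      [ConnectedSpace N] [ChartedSpace (EuclideanSpace ℝ (Fin m)) N] [IsManifold (𝓡 m) ∞ N]
      (F : EuclideanSpace ℝ (Fin (m + 1)) → ℝ) (e : N → EuclideanSpace ℝ (Fin (m + 1))),
      ContDiff ℝ ∞ F → IsCompact {x | F x ≤ 0} → (∀ x, F x = 0 → fderiv ℝ F x ≠ 0) →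
      Manifold.IsSmoothEmbedding (𝓡 m) 𝓘(ℝ, EuclideanSpace ℝ (Fin (m + 1))) ∞ e → range e = {x | F x = 0} →
      RelPiOneTrivial {x : EuclideanSpace ℝ (Fin (m + 1)) // F x ≤ 0} {p | F p.1 = 0} →
      ∃ (Φ : N × unitInterval → EuclideanSpace ℝ (Fin (m + 1))) (F' : EuclideanSpace ℝ (Fin (m + 1)) → ℝ),
        Manifold.IsSmoothEmbedding ((𝓡 m).prod (𝓡∂ 1)) 𝓘(ℝ, EuclideanSpace ℝ (Fin (m + 1))) ∞ Φ ∧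
        (∀ p : N, Φ (p, 0) = e p) ∧
        ContDiff ℝ ∞ F' ∧ IsCompact {x | F' x ≤ 0} ∧ (∀ x, F' x = 0 → fderiv ℝ F' x ≠ 0) ∧
        range (fun p : N => Φ (p, 1)) = {x | F' x = 0} ∧
        ∀ x, F' x = 0 → ∀ v : Fin m → EuclideanSpace ℝ (Fin (m + 1)), Orthonormal ℝ v →
          (∀ i, fderiv ℝ F' x (v i) = 0) → 0 < ∑ i, iteratedFDeriv ℝ 2 F' x ![v i, v i]

end Literature.Geometry.Riemannian

end
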